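import Summits.ResolutionOfSingularities.ResolutionOfSingularities.Theorems.RadicialJungCleanModelsCleanPermissibleCurveCriterion
import Summits.ResolutionOfSingularities.ResolutionOfSingularities.Theorems.RadicialJungCleanModelsCleanPermissibleBlowupWitness
import Literature.AlgebraicGeometry.Resolution.RsopLocalization
import HarnessLib

/-!
# Route `RadicialJung`, crux `CleanModels` (stmt-ResolutionOfSingularities-15917), line `Sketch` rev 35, stub 6 `stub_cleanProp44` (X44c):
# THE CORNER WITNESS — a line through the corner of a two-factor clean representative is NOT clean-permissible, the axes ARE

Seat `leafhand-res-radicialjung-1` g0 (land-only hand).  Fourth witness of the series (`…CleanPermissibleLeadWitness`, `…BlowupWitness`,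
`…ContactOrder`), and the first APPLICATION of the packaged second-order criterion `not_cleanPermissibleAt_of_derivations₂`
(`…CleanPermissibleCurveCriterion.lean`).

Where the line of `G` has a TWO-factor loose clean form (1) representative `h = x · y` (exponents `1, 1`; the CORNER of the divisor of the clean
representative — e.g. a point of a clean stage lying on an older exceptional component, or the crossing stage of memo
`Sketch-memo-hand2-g12-stubs-5-7.md` §3 read in the other chart), consider the curves inside the plane `V(z)` through the point: in an abstract regular
local ring `R` of dimension `3` with regular system of parameters `(x, y, z)`,

* `cleanPermissibleAt_axis_cornerWitness` — the AXIS `V(z, x)` (a branch direction) IS clean-permissible (adapted system `(z, x; y)`, `h = x¹ y¹`);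
  by symmetry so is `V(z, y)`;
* `not_cleanPermissibleAt_diagonal_cornerWitness` — the DIAGONAL `V(z, x - y)` (transversal to both branches) is NOT clean-permissible (`p` odd,
  residue field `p`-perfect), given `∂_z` (`∂_z x = ∂_z y = 0`, `∂_z z = 1`) and the Euler-type derivation `δ` VANISHING AT THE POINT with
  `δ x = x`, `δ y = -y`, `δ z = 0` (in coordinates `δ = x ∂_x - y ∂_y`, which kills `x y`), both extending along `f : R → F`.  First order:
  a minimal generator `α z + β (x - y)` has `∂_z (·) ≡ α` and `δ (·) ≡ 2 β x (mod (z, x - y))`; second order: for a transversal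
  `w = A x + B y + Γ z` (`A + B` a unit), `δ w ≡ A x - B y (mod 𝔪²)` cannot lie in `w 𝔪 ⊆ 𝔪²`.

Reading for X44c: near lines through a corner of the clean divisor in a non-axis direction are where insertions («births», memo 4e §2.4–2.6,
`…BirthCorner*.lean`) are forced; axis directions are free.  All hypotheses hold in `k[x, y, z]_{(x,y,z)}`, `k` perfect of odd characteristic.
Honest framing: OURS, elementary; nothing here proves X44c, any case of `CleanModels`, or resolution of singularities in characteristic `p`.
Setting only: [cite: CossartPiltant2008, Prop. 4.4, Lemma 4.3 (5)] [cite: Piltant2013, §2 Axiom 4] [cite: Matsumura1987, Thm. 14.2].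
-/

noncomputable section

set_option linter.dupNamespace false -- mandated namespace of this single-conjunct summit

open IsLocalRing
open Literature.AlgebraicGeometry.Resolution
open Summit.ResolutionOfSingularities.ResolutionOfSingularities.Theorems.CampaignW46.MohWindowSurfaceResidualOrder (range_vec3)

namespace Summit.ResolutionOfSingularities.ResolutionOfSingularities.Theorems.RadicialJung.CleanModels

universe u v

section CornerWitness

variable {R : Type u} [CommRing R] [IsLocalRing R]

/-- The coordinates `(z, x, y)` generate `𝔪` when `(x, y, z)` do. [folklore] -/
theorem span_axis_coords_eq {x y z : R} (h : Ideal.span ({x, y, z} : Set R) = maximalIdeal R) :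
    Ideal.span ({z, x, y} : Set R) = maximalIdeal R := by
  rw [← h]
  apply le_antisymm <;>
  · rw [Ideal.span_le, Set.insert_subset_iff, Set.insert_subset_iff, Set.singleton_subset_iff]
    exact ⟨Ideal.subset_span (by simp), Ideal.subset_span (by simp), Ideal.subset_span (by simp)⟩

/-- **The axis is clean-permissible**: `V(z, x)` is clean-permissible at `R` for the line of `G = x y` — adapted system `c = (z, x)`, `w = y`,
representative `x¹ · y¹`. [cite: Piltant2013, §2 Axiom 4] -/
theorem cleanPermissibleAt_axis_cornerWitness {F : Type v} [Field F] {p : ℕ} [hp : Fact p.Prime] (f : R →+* F)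
    (hR : IsRegularLocalRing R) (hdim : ringKrullDim R = 3) {x y z : R} (h : Ideal.span ({x, y, z} : Set R) = maximalIdeal R) :
    CleanPermissibleAt p f (f (x * y)) (Ideal.span ({z, x} : Set R)) := by
  classical
  have h1p : 1 < p := hp.out.one_lt
  refine ⟨hR, 2, 1, ![z, x], ![y], ?_, by rw [hdim]; norm_cast, ?_, Pi.single (⟨1, h1p⟩ : Fin p) (1 : F),
    ⟨⟨1, h1p⟩, one_ne_zero, by simp⟩, Or.inl ⟨![0, 1], ![1], 1, isUnit_one, Or.inl ⟨1, by simpa using hp.out.one_lt.ne'⟩, ?_⟩⟩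
  · have happ : Fin.append ![z, x] ![y] = ![z, x, y] := by
      ext i; fin_cases i <;> rfl
    rw [happ, range_vec3, span_axis_coords_eq h]
  · congr 1
    ext a
    simp only [Set.mem_range, Set.mem_insert_iff, Set.mem_singleton_iff]
    constructor
    · rintro ⟨i, rfl⟩
      fin_cases i <;> simp
    · rintro (rfl | rfl)
      exacts [⟨0, rfl⟩, ⟨1, rfl⟩]
  · have hsum : (∑ j : Fin p, (Pi.single (⟨1, h1p⟩ : Fin p) (1 : F) : Fin p → F) j ^ p * f (x * y) ^ (j : ℕ)) = f (x * y) := by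
      rw [Finset.sum_eq_single (⟨1, h1p⟩ : Fin p)]
      · simp
      · intro j _ hj
        rw [Pi.single_eq_of_ne hj, zero_pow hp.out.ne_zero, zero_mul]
      · intro h; exact absurd (Finset.mem_univ _) h
    rw [hsum]
    simp

/-- The regular system `(z, x - y, x)` behind the diagonal `V(z, x - y)`. [folklore] -/
theorem isRsopPart_diagonal_cornerWitness (hR : IsRegularLocalRing R) (hdim : ringKrullDim R = 3) {x y z : R}
    (h : Ideal.span ({x, y, z} : Set R) = maximalIdeal R) : IsRsopPart ![z, x - y, x] := by
  refine ⟨hR, 0, Fin.elim0, by rw [hdim]; norm_cast, ?_⟩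
  have h0 : Set.range (Fin.elim0 : Fin 0 → R) = ∅ := Set.range_eq_empty _
  rw [h0, Set.union_empty, range_vec3, ← h]
  apply le_antisymm
  · rw [Ideal.span_le, Set.insert_subset_iff, Set.insert_subset_iff, Set.singleton_subset_iff]
    exact ⟨Ideal.subset_span (by simp), Ideal.sub_mem _ (Ideal.subset_span (by simp)) (Ideal.subset_span (by simp)),
      Ideal.subset_span (by simp)⟩
  · rw [Ideal.span_le, Set.insert_subset_iff, Set.insert_subset_iff, Set.singleton_subset_iff]
    refine ⟨Ideal.subset_span (by simp), ?_, Ideal.subset_span (by simp)⟩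
    have hy : x - (x - y) ∈ Ideal.span ({z, x - y, x} : Set R) :=
      Ideal.sub_mem _ (Ideal.subset_span (by simp)) (Ideal.subset_span (by simp))
    rw [SetLike.mem_coe]
    convert hy using 1
    ring

/-- `I = (z, x - y)` is prime of height `≥ 2` and does not contain `x`. [cite: Matsumura1987, Thm. 14.3] -/
theorem diagonal_cornerWitness_prime (hR : IsRegularLocalRing R) (hdim : ringKrullDim R = 3) {x y z : R}
    (h : Ideal.span ({x, y, z} : Set R) = maximalIdeal R) :
    (Ideal.span ({z, x - y} : Set R)).IsPrime ∧ x ∉ Ideal.span ({z, x - y} : Set R) ∧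
      (2 : ℕ∞) ≤ (Ideal.span ({z, x - y} : Set R)).height := by
  have hw := isRsopPart_diagonal_cornerWitness hR hdim h
  have hcomp : Set.range ((![z, x - y, x] : Fin 3 → R) ∘ Fin.castLE (by norm_num : 2 ≤ 3)) = {z, x - y} := by
    ext a
    simp only [Set.mem_range, Function.comp_apply, Set.mem_insert_iff, Set.mem_singleton_iff]
    constructor
    · rintro ⟨i, rfl⟩
      fin_cases i
      · exact Or.inl rfl
      · exact Or.inr rfl
    · rintro (rfl | rfl)
      · exact ⟨0, rfl⟩
      · exact ⟨1, rfl⟩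
  have hw2 := hw.comp (Fin.castLE (by norm_num : 2 ≤ 3)) (Fin.castLE_injective _)
  refine ⟨?_, ?_, ?_⟩
  · have hpr := hw2.isPrime_span_range
    rwa [hcomp] at hpr
  · have hne := hw.not_mem_span_image (S := ({0, 1} : Set (Fin 3))) (i := 2) (by decide)
    rwa [Set.image_insert_eq, Set.image_singleton] at hne
  · have hh := hw2.height_span_range
    rw [hcomp] at hh
    rw [hh]; norm_num

/-- Corner, step (i): a minimal generator `c` of `I = (z, x - y)` dividing `∂_z c` does not divide `δ c` (`p` odd).  Writing `c = α z + β (x - y)`: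
`∂_z c ≡ α (mod 𝔪)` forces `α ∈ 𝔪`, hence `β` is a unit; then `δ c ≡ 2 β x (mod I)` and `c ∣ δ c` would put `x` in the prime `I`.
[cite: Matsumura1987, Thm. 14.2] -/
theorem corner_gen (hR : IsRegularLocalRing R) (hdim : ringKrullDim R = 3) {p : ℕ} [Fact p.Prime] [CharP R p] (hp2 : p ≠ 2)
    {x y z : R} (h : Ideal.span ({x, y, z} : Set R) = maximalIdeal R) (dz δ : Derivation ℤ R R)
    (hzx : dz x = 0) (hzy : dz y = 0) (hzz : dz z = 1) (hδx : δ x = x) (hδy : δ y = -y) (hδz : δ z = 0) {c : R}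
    (hcI : c ∈ Ideal.span ({z, x - y} : Set R)) (hc2 : c ∉ maximalIdeal R ^ 2) (hdvd : c ∣ dz c) : ¬ c ∣ δ c := by
  set I : Ideal R := Ideal.span ({z, x - y} : Set R) with hI
  obtain ⟨hIprime, hxI, -⟩ := diagonal_cornerWitness_prime hR hdim h
  have hIm : I ≤ maximalIdeal R := IsLocalRing.le_maximalIdeal hIprime.ne_top
  have hxm : x ∈ maximalIdeal R := h ▸ Ideal.subset_span (by simp)
  have hym : y ∈ maximalIdeal R := h ▸ Ideal.subset_span (by simp)
  have hzm : z ∈ maximalIdeal R := h ▸ Ideal.subset_span (by simp)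
  have hxym : x - y ∈ maximalIdeal R := Ideal.sub_mem _ hxm hym
  have hcm : c ∈ maximalIdeal R := hIm hcI
  have hzI : z ∈ I := Ideal.subset_span (by simp)
  have hxyI : x - y ∈ I := Ideal.subset_span (by simp)
  obtain ⟨α, β, hc⟩ := Ideal.mem_span_pair.mp hcI
  -- `∂_z c ≡ α (mod 𝔪)` forces `α ∈ 𝔪`
  have hdzc : dz c = α + (z * dz α + (x - y) * dz β) := by
    rw [← hc, map_add, Derivation.leibniz, Derivation.leibniz, map_sub, hzx, hzy, hzz]
    simp only [smul_eq_mul]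
    ring
  have hα : α ∈ maximalIdeal R := by
    obtain ⟨r, hr⟩ := hdvd
    have h1 : α = c * r - (z * dz α + (x - y) * dz β) := by rw [← hr, hdzc]; ring
    rw [h1]
    exact Ideal.sub_mem _ (Ideal.mul_mem_right _ _ hcm)
      (Ideal.add_mem _ (Ideal.mul_mem_right _ _ hzm) (Ideal.mul_mem_right _ _ hxym))
  -- hence `β` is a unit
  have hβ : IsUnit β := by
    by_contra hβ
    have hβm : β ∈ maximalIdeal R := (IsLocalRing.mem_maximalIdeal β).mpr hβ
    apply hc2
    rw [← hc, pow_two]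
    exact Ideal.add_mem _ (Ideal.mul_mem_mul hα hzm) (Ideal.mul_mem_mul hβm hxym)
  -- `δ c ≡ 2 β x (mod I)`
  have hδc : δ c = 2 * β * x + (z * δ α + (x - y) * (δ β - β)) := by
    rw [← hc, map_add, Derivation.leibniz, Derivation.leibniz, map_sub, hδx, hδy, hδz]
    simp only [smul_eq_mul]
    ring
  intro hdvdδ
  have hδcI : δ c ∈ I := by
    obtain ⟨r, hr⟩ := hdvdδ
    rw [hr]; exact Ideal.mul_mem_right _ _ hcI
  have h2βx : 2 * β * x ∈ I := by
    have h1 : 2 * β * x = δ c - (z * δ α + (x - y) * (δ β - β)) := by rw [hδc]; ring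
    rw [h1]
    exact Ideal.sub_mem _ hδcI (Ideal.add_mem _ (Ideal.mul_mem_right _ _ hzI) (Ideal.mul_mem_right _ _ hxyI))
  have h2 : IsUnit (2 : R) := by
    have h2' := isUnit_natCast_of_not_dvd p (S := R)
      (fun hd => hp2 ((Nat.prime_dvd_prime_iff_eq Fact.out Nat.prime_two).mp hd))
    simpa using h2'
  exact hxI ((Ideal.unit_mul_mem_iff_mem I (h2.mul hβ)).mp (by simpa [mul_assoc] using h2βx))

/-- Corner, step (ii): for a parameter `w` transversal to `I = (z, x - y)`, `δ w ∉ w 𝔪`.  Writing `w = A x + B y + Γ z`: transversality makes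
`A + B` a unit (`z, x - y ∈ I`, `w ≡ (A + B) x` modulo `I + 𝔪²`), while `δ w ≡ A x - B y (mod 𝔪²)`; `δ w ∈ w 𝔪 ⊆ 𝔪²` would force `A, B ∈ 𝔪`.
[cite: Matsumura1987, Thm. 14.2] -/
theorem corner_trans (hR : IsRegularLocalRing R) (hdim : ringKrullDim R = 3) {x y z : R}
    (h : Ideal.span ({x, y, z} : Set R) = maximalIdeal R) (δ : Derivation ℤ R R) (hδm : ∀ r : R, δ r ∈ maximalIdeal R)
    (hδx : δ x = x) (hδy : δ y = -y) (hδz : δ z = 0) {w : R} (hwm : w ∈ maximalIdeal R)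
    (hw2 : w ∉ Ideal.span ({z, x - y} : Set R) ⊔ maximalIdeal R ^ 2) {r : R} (hr : r ∈ maximalIdeal R) (hδw : δ w = w * r) : False := by
  have hxyz := isRsopPart_vec3_of_span_eq hR hdim h
  set I : Ideal R := Ideal.span ({z, x - y} : Set R) with hI
  have hxm : x ∈ maximalIdeal R := h ▸ Ideal.subset_span (by simp)
  have hym : y ∈ maximalIdeal R := h ▸ Ideal.subset_span (by simp)
  have hzm : z ∈ maximalIdeal R := h ▸ Ideal.subset_span (by simp)
  obtain ⟨A, B, Γ, hw⟩ := exists_eq_combination_of_mem_span_triple (h ▸ hwm : w ∈ Ideal.span ({x, y, z} : Set R))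
  -- `A + B` is a unit
  have hAB : IsUnit (A + B) := by
    by_contra hAB
    have hABm : A + B ∈ maximalIdeal R := (IsLocalRing.mem_maximalIdeal _).mpr hAB
    apply hw2
    have h1 : w = (A + B) * x - B * (x - y) + Γ * z := by rw [hw]; ring
    rw [h1]
    refine Ideal.add_mem _ (Ideal.sub_mem _ (Ideal.mem_sup_right ?_)
      (Ideal.mem_sup_left (Ideal.mul_mem_left _ _ (Ideal.subset_span (by simp)))))
      (Ideal.mem_sup_left (Ideal.mul_mem_left _ _ (Ideal.subset_span (by simp))))
    rw [pow_two]
    exact Ideal.mul_mem_mul hABm hxm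
  -- `δ w ≡ A x - B y (mod 𝔪²)`
  have hδw' : δ w = A * x + (-B) * y + (x * δ A + y * δ B + z * δ Γ) := by
    rw [hw, map_add, map_add, Derivation.leibniz, Derivation.leibniz, Derivation.leibniz, hδx, hδy, hδz]
    simp only [smul_eq_mul]
    ring
  have hsq : A * x + (-B) * y ∈ maximalIdeal R ^ 2 := by
    have h1 : A * x + (-B) * y = w * r - (x * δ A + y * δ B + z * δ Γ) := by rw [← hδw, hδw']; ring
    rw [h1, pow_two]
    exact Ideal.sub_mem _ (Ideal.mul_mem_mul hwm hr)
      (Ideal.add_mem _ (Ideal.add_mem _ (Ideal.mul_mem_mul hxm (hδm A)) (Ideal.mul_mem_mul hym (hδm B)))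
        (Ideal.mul_mem_mul hzm (hδm Γ)))
  have hrel : ∑ i, (![A, -B, 0] : Fin 3 → R) i * (![x, y, z] : Fin 3 → R) i ∈ maximalIdeal R ^ 2 := by
    simpa [Fin.sum_univ_three] using hsq
  have hA : A ∈ maximalIdeal R := by
    simpa using hxyz.forall_mem_maximalIdeal_of_sum_mul_mem_sq _ hrel 0
  have hB : B ∈ maximalIdeal R := by
    have hB' : -B ∈ maximalIdeal R := by simpa using hxyz.forall_mem_maximalIdeal_of_sum_mul_mem_sq _ hrel 1
    simpa using neg_mem hB'
  exact (IsLocalRing.mem_maximalIdeal _).mp (Ideal.add_mem _ hA hB) hAB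

/-- **The diagonal through the corner is NOT clean-permissible.**  `R` regular local of dimension `3` with regular system of parameters `(x, y, z)`,
embedded by `f` in a field `F` of ODD characteristic `p`, residue field `p`-perfect; `∂_z` a derivation of `R` with `∂_z x = ∂_z y = 0`,
`∂_z z = 1`, and `δ` a derivation VANISHING AT THE POINT (`δ (R) ⊆ 𝔪`) with `δ x = x`, `δ y = -y`, `δ z = 0` (in coordinates `δ = x ∂_x - y ∂_y`,
which kills `x y`), both extending along `f` — all true in `k[x, y, z]_{(x,y,z)}`, `k` perfect.  Then the diagonal `V(z, x - y)` is NOT clean-permissible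
for the line of the two-factor clean representative `G = x y` (application of `not_cleanPermissibleAt_of_derivations₂`).
[cite: Piltant2013, §2 Axiom 4] [cite: CossartPiltant2008, Lemma 4.3 (5)] -/
theorem not_cleanPermissibleAt_diagonal_cornerWitness {R : Type u} {F : Type u} [CommRing R] [IsLocalRing R] [Field F] {p : ℕ}
    [Fact p.Prime] [CharP F p] (hp2 : p ≠ 2) {f : R →+* F} (hf : Function.Injective f) (hR : IsRegularLocalRing R)
    (hdim : ringKrullDim R = 3) {x y z : R} (h : Ideal.span ({x, y, z} : Set R) = maximalIdeal R)
    (hperf : ∀ u : R, ∃ c : R, u - c ^ p ∈ maximalIdeal R)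
    (dz δ : Derivation ℤ R R) (Dz Δ : Derivation ℤ F F) (hDz : ∀ r, Dz (f r) = f (dz r)) (hΔ : ∀ r, Δ (f r) = f (δ r))
    (hzx : dz x = 0) (hzy : dz y = 0) (hzz : dz z = 1)
    (hδm : ∀ r : R, δ r ∈ maximalIdeal R) (hδx : δ x = x) (hδy : δ y = -y) (hδz : δ z = 0) :
    ¬ CleanPermissibleAt p f (f (x * y)) (Ideal.span ({z, x - y} : Set R)) := by
  haveI : CharP R p := f.charP hf p
  obtain ⟨-, -, hht⟩ := diagonal_cornerWitness_prime hR hdim h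
  -- both derivations kill `G = x y`
  have hDzG : Dz (f (x * y)) = 0 := by
    rw [hDz, Derivation.leibniz, hzx, hzy]; simp
  have hΔG : Δ (f (x * y)) = 0 := by
    rw [hΔ, Derivation.leibniz, hδx, hδy]; simp only [smul_eq_mul]; rw [show x * -y + y * x = 0 by ring, map_zero]
  refine not_cleanPermissibleAt_of_derivations₂ hf hperf (N := 3) hdim (by simpa using hht) (fun c hcI hc2 => ?_)
    (fun w hwm hw2 => ⟨Δ, δ, hΔ, hΔG, hδm, fun r hr hδw => corner_trans hR hdim h δ hδm hδx hδy hδz hwm hw2 hr hδw⟩)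
  by_cases hdvd : c ∣ dz c
  · exact ⟨Δ, δ, hΔ, hΔG, corner_gen hR hdim hp2 h dz δ hzx hzy hzz hδx hδy hδz hcI hc2 hdvd⟩
  · exact ⟨Dz, dz, hDz, hDzG, hdvd⟩

end CornerWitness

end Summit.ResolutionOfSingularities.ResolutionOfSingularities.Theorems.RadicialJung.CleanModels

end
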